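import Literature.Geometry.Lorentzian.LocalCauchyLensShape
import Literature.Geometry.Lorentzian.CoordSliceDataEmbedding
import Literature.Geometry.Lorentzian.CausalityOpennessProofs
import Literature.Geometry.Lorentzian.IsometryProofs
import Literature.Geometry.Lorentzian.CommonDevelopmentEmbedding
import Summits.FinalStateConjecture.FinalStateConjecture.Theorems.SwallowTheDatumSubdataDevelopmentsEmbedRestartPrep
import Summits.FinalStateConjecture.FinalStateConjecture.Theorems.SwallowTheDatumSubdataDevelopmentsEmbedRestartChart
import HarnessLib

/-!
# Route SwallowTheDatum · item `SubdataDevelopmentsEmbed` (stmt-FinalStateConjecture-10053) —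
# the coordinate construction of the restart: two local developments of the common slice data
# (Sbierski 2016, §3.2, proof of Thm. 12)

Fourth of five files: `exists_sliceDevelopments_of_boundaryData` constructs, in a chart adapted to
the time function at the boundary point, one initial data set on a ball of the slice `{f = 0}` and
two vacuum data embeddings of it (for `g₁`, and for the pullback of `g₂` along the local extension
`ψ` of the glueing map) with lens neighbourhoods in which the slice is Cauchy, and the isometric
open embeddings back into `M₁`, `M₂` — the input of `exists_restart_of_sliceDevelopments`
(`…RestartLU.lean`), assembled in `…Restart.lean`. Everything is proved; no definitions, no named
facts.
-/

noncomputable section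

open Bundle Set Function Filter TopologicalSpace Manifold Topology Metric
open scoped Manifold ContDiff Topology

namespace Summit.FinalStateConjecture.FinalStateConjecture.Theorems

namespace SubdataDevelopmentsEmbed

open Literature.Geometry.Lorentzian

/-! ### The coordinate construction -/

set_option maxHeartbeats 800000 in
/-- **The two local developments of the common slice data at a spacelike boundary point**
(Sbierski 2016, §3.2, proof of Thm. 12: "suitable neighbourhoods of `S` in `M` and of `ψ(S)` in
`M'` are GHDs of `(S, ḡ_S, k_S)`"), from the boundary data (H1)–(H4): in a chart `Φ` at `p₀`
adapted to `f` with ball-shaped target `T`, one initial data set `D` on a ball `B` of the slice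
`{x⁰ = 0}` induced by BOTH metrics `(Φ⁻¹)^* g₁`, `(ψ ∘ Φ⁻¹)^* g₂` (they agree to first order along
the slice, `CoordSlice.eq_and_fderiv_eq_of_eqOn`, `CoordSlice.initialDataSet_congr`), two vacuum
data embeddings `𝒮a`, `𝒮b` of `D` (`CoordSlice.sliceDataEmbedding`) with lenses over the same ball
in which the slice is Cauchy (`exists_isCauchyHypersurface_restrict_lens_opens`), the isometric open
embeddings `Φ⁻¹`, `ψ ∘ Φ⁻¹` into `M₁`, `M₂`, the identification `e = id` of the slices, and the
bookkeeping `range Φ⁻¹ ⊆ W ∩ I±`, `f = 0` on the slice, `p₀` on the slice — the input of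
`exists_restart_of_sliceDevelopments`. [cite: Sbierski2016AHP, §3.2, proof of Thm. 12 (arXiv: pp. 15–16)] -/
theorem exists_sliceDevelopments_of_boundaryData
    {N : Type} [TopologicalSpace N] [ChartedSpace E3 N] [IsManifold (𝓡 3) ∞ N] [ConnectedSpace N]
    {D₁ : InitialDataSet (𝓡 3) N} (𝒟₁ 𝒟₂ : VacuumCauchyDevelopment D₁)
    (𝔠 : CauchyDevelopment.CommonDevelopment 𝒟₁.toCauchyDevelopment 𝒟₂.toCauchyDevelopment)
    {p₀ : 𝒟₁.carrier}
    (hp₀I : p₀ ∈ 𝒟₁.metric.chronologicalFuture 𝒟₁.timeOrientation (range 𝒟₁.embed) ∨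
      p₀ ∈ 𝒟₁.metric.chronologicalPast 𝒟₁.timeOrientation (range 𝒟₁.embed))
    {W : Set 𝒟₁.carrier} (hW : IsOpen W) (hp₀W : p₀ ∈ W)
    {f : 𝒟₁.carrier → ℝ} (hf : ContMDiffOn (𝓡 4) 𝓘(ℝ, ℝ) ∞ f W) (hfp₀ : f p₀ = 0)
    (hdf : ∀ v : TangentSpace (𝓡 4) p₀, 𝒟₁.timeOrientation.IsFutureDirected v →
      (0 : ℝ) < mfderiv (𝓡 4) 𝓘(ℝ, ℝ) f p₀ v)
    (hlevel : ∀ q ∈ W, f q = 0 → q ∈ closure (𝔠.opens : Set 𝒟₁.carrier))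
    {ψ : 𝒟₁.carrier → 𝒟₂.carrier} (hψs : ContMDiffOn (𝓡 4) (𝓡 4) ∞ ψ W)
    (hψU : ∀ (q : 𝒟₁.carrier) (hq : q ∈ 𝔠.opens), q ∈ W → ψ q = 𝔠.map ⟨q, hq⟩)
    (hdψ : Injective (mfderiv (𝓡 4) (𝓡 4) ψ p₀)) :
    ∃ (B : Opens E3) (_ : ConnectedSpace B) (D : InitialDataSet (𝓡 3) B) (𝒮a 𝒮b : DataEmbedding D)
      (Va : Opens 𝒮a.carrier) (hιa : ∀ y, 𝒮a.embed y ∈ Va) (Vb : Opens 𝒮b.carrier)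
      (hιb : ∀ y, 𝒮b.embed y ∈ Vb) (χa : 𝒮a.carrier → 𝒟₁.carrier) (χb : 𝒮b.carrier → 𝒟₂.carrier)
      (e : 𝒮a.carrier → 𝒮b.carrier),
      𝒮a.IsVacuum ∧ 𝒮b.IsVacuum ∧ IsConnected (Va : Set 𝒮a.carrier) ∧
      (𝒮a.metric.restrict PseudoRiemannianMetric.contMDiff_restrict_holds Va).IsCauchyHypersurface
        (𝒮a.timeOrientation.restrict PseudoRiemannianMetric.contMDiff_restrict_holds
          𝒮a.timeOrientation.contMDiff_restrict_holds Va) (range (𝒮a.embedOpens Va hιa)) ∧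
      IsConnected (Vb : Set 𝒮b.carrier) ∧
      (𝒮b.metric.restrict PseudoRiemannianMetric.contMDiff_restrict_holds Vb).IsCauchyHypersurface
        (𝒮b.timeOrientation.restrict PseudoRiemannianMetric.contMDiff_restrict_holds
          𝒮b.timeOrientation.contMDiff_restrict_holds Vb) (range (𝒮b.embedOpens Vb hιb)) ∧
      IsOpenEmbedding χa ∧ 𝒮a.metric.IsIsometricImmersion 𝒟₁.metric.toPseudoRiemannianMetric χa ∧
      𝒮a.timeOrientation.PreservesTimeOrientation χa 𝒟₁.timeOrientation ∧
      IsOpenEmbedding χb ∧ 𝒮b.metric.IsIsometricImmersion 𝒟₂.metric.toPseudoRiemannianMetric χb ∧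
      𝒮b.timeOrientation.PreservesTimeOrientation χb 𝒟₂.timeOrientation ∧
      e ∘ 𝒮a.embed = 𝒮b.embed ∧ (∀ y, MDifferentiableAt (𝓡 4) (𝓡 4) e (𝒮a.embed y)) ∧
      (∀ y, mfderiv (𝓡 4) (𝓡 4) e (𝒮a.embed y) (𝒮a.normal y) = 𝒮b.normal y) ∧
      (∀ x, ψ (χa x) = χb (e x)) ∧
      range χa ⊆ W ∧
      (range χa ⊆ 𝒟₁.metric.chronologicalFuture 𝒟₁.timeOrientation (range 𝒟₁.embed) ∨
        range χa ⊆ 𝒟₁.metric.chronologicalPast 𝒟₁.timeOrientation (range 𝒟₁.embed)) ∧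
      (∀ y, f (χa (𝒮a.embed y)) = 0) ∧
      ∃ y, χa (𝒮a.embed y) = p₀ := by
  classical
  have hUo : IsOpen (𝔠.opens : Set 𝒟₁.carrier) := 𝔠.opens.isOpen
  /- Step 0: the causal side, and a neighbourhood on which `ψ` is an injective immersion -/
  obtain ⟨Ipm, hIpm_open, hp₀Ipm, hIpm⟩ : ∃ I : Set 𝒟₁.carrier, IsOpen I ∧ p₀ ∈ I ∧
      (I ⊆ 𝒟₁.metric.chronologicalFuture 𝒟₁.timeOrientation (range 𝒟₁.embed) ∨
        I ⊆ 𝒟₁.metric.chronologicalPast 𝒟₁.timeOrientation (range 𝒟₁.embed)) := by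
    rcases hp₀I with h | h
    · exact ⟨_, 𝒟₁.metric.isOpen_chronologicalFuture_of_boundaryless 𝒟₁.timeOrientation _, h,
        Or.inl Subset.rfl⟩
    · exact ⟨_, 𝒟₁.metric.isOpen_chronologicalPast_of_boundaryless 𝒟₁.timeOrientation _, h,
        Or.inr Subset.rfl⟩
  obtain ⟨Oψ, hOψ_open, hp₀Oψ, hOψW, hψinj, hψimm⟩ :=
    exists_nhds_injOn_injective_mfderiv hW hp₀W hψs hdψ
  set O : Set 𝒟₁.carrier := Oψ ∩ Ipm with hO_def
  have hO_open : IsOpen O := hOψ_open.inter hIpm_open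
  have hp₀O : p₀ ∈ O := ⟨hp₀Oψ, hp₀Ipm⟩
  have hOW : O ⊆ W := fun q hq ↦ hOψW hq.1
  /- Step 1: the adapted chart with ball-shaped target -/
  have hdf0 : ∃ v : TangentSpace (𝓡 4) p₀, mfderiv (𝓡 4) 𝓘(ℝ, ℝ) f p₀ v ≠ 0 :=
    ⟨𝒟₁.timeOrientation.vectorField p₀,
      (hdf _ (𝒟₁.timeOrientation.isFutureDirected_vectorField p₀)).ne'⟩
  obtain ⟨Φ, hΦ, hp₀Φ, hΦO, hΦf, r, hr, hΦT⟩ :=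
    exists_adapted_chart_ball hO_open hp₀O (hf.mono hOW) hdf0
  set T : Opens E4 := CoordChart.target Φ with hT_def
  have hTball : (T : Set E4) = ball (Φ p₀) r := hΦT
  set x₀ : E4 := Φ p₀ with hx₀_def
  have hx₀T : x₀ ∈ Φ.target := Φ.map_source hp₀Φ
  have hx₀0 : x₀ 0 = 0 := by rw [hx₀_def, hΦf p₀ hp₀Φ, hfp₀]
  set a : T := ⟨x₀, hx₀T⟩ with ha_def
  have hsymm₀ : Φ.symm x₀ = p₀ := Φ.left_inv hp₀Φ
  have hTconn : IsConnected (T : Set E4) := by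
    rw [hTball]; exact (convex_ball _ _).isConnected ⟨x₀, mem_ball_self hr⟩
  have hΦsrcW : Φ.source ⊆ W := hΦO.trans hOW
  have hdt : ∀ q ∈ Φ.source, CoordSlice.dt (Φ q) = f q := fun q hq ↦ by
    rw [CoordSlice.dt_apply]; exact hΦf q hq
  /- Step 2: the two time-oriented vacuum metrics on the chart target -/
  set gT : LorentzianMetric 𝓘(ℝ, E4) ∞ T := CoordChart.lorentzMetric 𝒟₁.metric hΦ with hgT_def
  set τT : TimeOrientation gT := CoordChart.timeOrientation 𝒟₁.metric 𝒟₁.timeOrientation hΦ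
  set G := CoordChart.metricRepr 𝒟₁.metric.toPseudoRiemannianMetric hΦ with hG_def
  have hG : ∀ x : T, gT.val x = G x := CoordChart.lorentzMetric_val_eq_repr 𝒟₁.metric hΦ
  set ψΦ : T → 𝒟₂.carrier := fun x ↦ ψ (CoordChart.inv Φ x) with hψΦ_def
  have hinvs : ContMDiff 𝓘(ℝ, E4) (𝓡 4) ∞ (CoordChart.inv Φ) := CoordChart.contMDiff_inv' hΦ
  have hinvO : ∀ x : T, CoordChart.inv Φ x ∈ O := fun x ↦ hΦO (CoordChart.inv_mem_source x)
  obtain ⟨hψΦs', hψd, hmfψΦ, hψΦinj, hψΦinjective⟩ :=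
    chartPushforward_props hΦ hOψ_open (hψs.mono hOψW) (hΦO.trans inter_subset_left) hψinj hψimm
  set gT' : LorentzianMetric 𝓘(ℝ, E4) ∞ T :=
    𝒟₂.metric.comap PseudoRiemannianMetric.contMDiff_pullbackBilin_holds ψΦ hψΦs' hψΦinj rfl
  set τT' : TimeOrientation gT' :=
    𝒟₂.timeOrientation.comap PseudoRiemannianMetric.contMDiff_pullbackBilin_holds
      𝒟₂.timeOrientation.contMDiff_comapFun_holds ψΦ hψΦs' hψΦinj rfl with hτT'_def
  set G' : E4 → E4 →L[ℝ] E4 →L[ℝ] ℝ := fun x ↦ if hx : x ∈ Φ.target then gT'.val ⟨x, hx⟩ else 0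
    with hG'_def
  have hG' : ∀ x : T, gT'.val x = G' x := fun x ↦ by
    have hx : (x : E4) ∈ Φ.target := x.2
    simp only [hG'_def, dif_pos hx]
  have keyG : ∀ (x : T) (u w : E4), gT.val x u w = G x u w := CoordSlice.val_apply_eq hG
  have keyG' : ∀ (x : T) (u w : E4), gT'.val x u w = G' x u w := CoordSlice.val_apply_eq hG'
  have hψΦi : gT'.IsIsometricImmersion 𝒟₂.metric.toPseudoRiemannianMetric ψΦ :=
    PseudoRiemannianMetric.isIsometricImmersion_comap
      PseudoRiemannianMetric.contMDiff_pullbackBilin_holds ψΦ hψΦs' hψΦinj rfl _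
  have hψΦτ : τT'.PreservesTimeOrientation ψΦ 𝒟₂.timeOrientation :=
    𝒟₂.timeOrientation.preservesTimeOrientation_comap
      PseudoRiemannianMetric.contMDiff_pullbackBilin_holds
      𝒟₂.timeOrientation.contMDiff_comapFun_holds ψΦ hψΦs' hψΦinj rfl
  have hinvi : gT.IsIsometricImmersion 𝒟₁.metric.toPseudoRiemannianMetric (CoordChart.inv Φ) :=
    CoordChart.isIsometricImmersion_inv 𝒟₁.metric hΦ
  have hinvτ : τT.PreservesTimeOrientation (CoordChart.inv Φ) 𝒟₁.timeOrientation :=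
    CoordChart.preservesTimeOrientation_inv 𝒟₁.metric 𝒟₁.timeOrientation hΦ
  have hinvo : IsOpenEmbedding (CoordChart.inv Φ) := CoordChart.isOpenEmbedding_inv Φ
  /- Step 3: the two metrics agree on `Φ(U ∩ Φ.source)`, hence to first order along the slice -/
  set O₀ : Set E4 := Φ '' ((𝔠.opens : Set 𝒟₁.carrier) ∩ Φ.source) with hO₀_def
  have hO₀_open : IsOpen O₀ :=
    Φ.isOpen_image_of_subset_source (hUo.inter Φ.open_source) inter_subset_right
  have hO₀T : O₀ ⊆ Φ.target := by
    rintro _ ⟨q, hq, rfl⟩; exact Φ.map_source hq.2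
  have hG'val : ∀ (x : T) (u w : E4), G' x u w = 𝒟₂.metric.val (ψ (CoordChart.inv Φ x))
      (mfderiv (𝓡 4) (𝓡 4) ψ (CoordChart.inv Φ x) (mfderiv 𝓘(ℝ, E4) (𝓡 4) (CoordChart.inv Φ) x u))
      (mfderiv (𝓡 4) (𝓡 4) ψ (CoordChart.inv Φ x) (mfderiv 𝓘(ℝ, E4) (𝓡 4) (CoordChart.inv Φ) x w)) :=
    fun x u w ↦ by
    rw [← keyG']
    change 𝒟₂.metric.val (ψΦ x) (mfderiv 𝓘(ℝ, E4) (𝓡 4) ψΦ x u)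
      (mfderiv 𝓘(ℝ, E4) (𝓡 4) ψΦ x w) = _
    rw [hmfψΦ x]
    rfl
  have hGG'O : EqOn G G' O₀ :=
    eqOn_repr_of_pullback_eq 𝒟₁.metric 𝒟₂.metric hΦ (U := (𝔠.opens : Set 𝒟₁.carrier))
      (fun q hq ↦ (agree_of_commonDevelopment 𝔠 hW hψs hψU hq.1 (hΦsrcW hq.2)).1) hG'val
  have hGsmooth : ContDiffOn ℝ 1 G Φ.target :=
    (CoordChart.contDiffOn_metricRepr 𝒟₁.metric.toPseudoRiemannianMetric hΦ).of_le
      (by exact_mod_cast le_top)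
  have hG'smooth : ContDiffOn ℝ 1 G' Φ.target := fun x hx ↦
    ((OpensChart.contDiffAt_repr (g := gT'.toPseudoRiemannianMetric) hG' ⟨x, hx⟩).of_le
      (by exact_mod_cast le_top)).contDiffWithinAt
  have hslice_closure : ∀ x : T, (x : E4) 0 = 0 → (x : E4) ∈ closure O₀ := fun x hx0 ↦
    mem_closure_image_of_level hΦf hΦsrcW hlevel x.2 hx0
  have hagree : ∀ x : T, (x : E4) 0 = 0 → G x = G' x ∧ fderiv ℝ G x = fderiv ℝ G' x :=
    fun x hx0 ↦ CoordSlice.eq_and_fderiv_eq_of_eqOn Φ.open_target hO₀_open hO₀T hGG'O hGsmooth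
      hG'smooth x.2 (hslice_closure x hx0)
  have hval_agree : ∀ x : T, (x : E4) 0 = 0 → ∀ u w : E4, gT.val x u w = gT'.val x u w :=
    fun x hx0 u w ↦ by rw [keyG, keyG', (hagree x hx0).1]
  have hPneg : ∀ x : T, (x : E4) ∈ O₀ →
      gT'.val x (τT'.vectorField x) (τT.vectorField x) < 0 := by
    intro x hxO
    obtain ⟨q, ⟨hqU, hqs⟩, hqx⟩ := hxO
    have hinvq : CoordChart.inv Φ x = q := by
      show Φ.symm x = q; rw [← hqx]; exact Φ.left_inv hqs
    have h1 : mfderiv 𝓘(ℝ, E4) (𝓡 4) ψΦ x (τT'.vectorField x) =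
        𝒟₂.timeOrientation.vectorField (ψΦ x) :=
      𝒟₂.timeOrientation.mfderiv_comapFun ψΦ hψΦinj rfl x
    have h2 : mfderiv 𝓘(ℝ, E4) (𝓡 4) (CoordChart.inv Φ) x (τT.vectorField x) =
        𝒟₁.timeOrientation.vectorField (CoordChart.inv Φ x) :=
      𝒟₁.timeOrientation.mfderiv_comapFun (CoordChart.inv Φ) (CoordChart.injective_mfderiv_inv hΦ)
        rfl x
    change 𝒟₂.metric.val (ψΦ x) (mfderiv 𝓘(ℝ, E4) (𝓡 4) ψΦ x (τT'.vectorField x))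
      (mfderiv 𝓘(ℝ, E4) (𝓡 4) ψΦ x (τT.vectorField x)) < 0
    rw [h1, hmfψΦ x, ContinuousLinearMap.comp_apply, h2, hinvq]
    have hψΦx : ψΦ x = ψ q := by
      show ψ (CoordChart.inv Φ x) = ψ q; rw [hinvq]
    rw [hψΦx]
    exact (agree_of_commonDevelopment 𝔠 hW hψs hψU hqU (hΦsrcW hqs)).2.2
  have hconex : ∀ x : T, (x : E4) 0 = 0 →
      gT'.val x (τT'.vectorField x) (τT.vectorField x) < 0 ∧ τT'.IsFutureDirected (τT.vectorField x) ∧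
        ∀ v : TangentSpace 𝓘(ℝ, E4) x, τT'.IsFutureDirected v → τT.IsFutureDirected v :=
    fun x hx0 ↦ cone_agree_of_closure τT τT' hG' hPneg (hslice_closure x hx0) (hval_agree x hx0)
  /- Step 4: the slices are spacelike near `x₀`; lens constants; the ball `B` -/
  have hfdp₀ : MDifferentiableAt (𝓡 4) 𝓘(ℝ, ℝ) f p₀ :=
    ((hf p₀ hp₀W).contMDiffAt (hW.mem_nhds hp₀W)).mdifferentiableAt (by simp)
  obtain ⟨hdtpos, r₁, hr₁, hr₁ab⟩ :=
    exists_radius_spacelike_slice 𝒟₁.metric 𝒟₁.timeOrientation hΦ hp₀Φ hfdp₀ hdf hdt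
  have hn1 : (1 : ℕ∞ω) ≤ ∞ := by exact_mod_cast le_top
  have hfslice : ContMDiffAt 𝓘(ℝ, E4) 𝓘(ℝ, ℝ) 1 (fun x : T ↦ CoordSlice.dt (x : E4)) a :=
    (OpensChart.contMDiff_clm_comp_val CoordSlice.dt) a
  have hfslice0 : CoordSlice.dt ((a : T) : E4) = 0 := hx₀0
  have hdfslice : ∀ v : TangentSpace 𝓘(ℝ, E4) a, τT.IsFutureDirected v →
      (0 : ℝ) < mfderiv 𝓘(ℝ, E4) 𝓘(ℝ, ℝ) (fun x : T ↦ CoordSlice.dt (x : E4)) a v := by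
    intro v hv
    rw [OpensChart.mfderiv_clm_comp_val]
    exact hdtpos v hv
  have hdfslice' : ∀ v : TangentSpace 𝓘(ℝ, E4) a, τT'.IsFutureDirected v →
      (0 : ℝ) < mfderiv 𝓘(ℝ, E4) 𝓘(ℝ, ℝ) (fun x : T ↦ CoordSlice.dt (x : E4)) a v :=
    fun v hv ↦ hdfslice v ((hconex a hx₀0).2.2 v hv)
  set Sl : Set T := {x : T | CoordSlice.dt (x : E4) = 0} with hSl_def
  have hSl : ∀ᶠ q in 𝓝 a, q ∈ Sl ↔ CoordSlice.dt (q : E4) = 0 :=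
    Filter.Eventually.of_forall fun _ ↦ Iff.rfl
  obtain ⟨ka, hka, ρa, hρa, Ha⟩ :=
    LorentzianMetric.exists_isCauchyHypersurface_restrict_lens_opens (g := gT) (τ := τT) hn1
      PseudoRiemannianMetric.contMDiff_restrict_holds τT.contMDiff_restrict_holds
      hfslice hfslice0 hdfslice hSl (W := univ) univ_mem
  obtain ⟨kb, hkb, ρb, hρb, Hb⟩ :=
    LorentzianMetric.exists_isCauchyHypersurface_restrict_lens_opens (g := gT') (τ := τT') hn1
      PseudoRiemannianMetric.contMDiff_restrict_holds τT'.contMDiff_restrict_holds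
      hfslice hfslice0 hdfslice' hSl (W := univ) univ_mem
  set ρ' : ℝ := min (min ρa ρb) (min r r₁) with hρ'_def
  have hρ' : 0 < ρ' := lt_min (lt_min hρa hρb) (lt_min hr hr₁)
  have hρ'a : ρ' ≤ ρa := (min_le_left _ _).trans (min_le_left _ _)
  have hρ'b : ρ' ≤ ρb := (min_le_left _ _).trans (min_le_right _ _)
  have hρ'r : ρ' ≤ r := (min_le_right _ _).trans (min_le_left _ _)
  have hρ'r₁ : ρ' ≤ r₁ := (min_le_right _ _).trans (min_le_right _ _)
  set y₀ : E3 := E4.spatial x₀ with hy₀_def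
  set B : Opens E3 := ⟨ball y₀ (ρ' / 2), isOpen_ball⟩ with hB_def
  have hmemB : ∀ y : E3, y ∈ B ↔ ‖y - y₀‖ < ρ' / 2 := fun y ↦ by
    show y ∈ ball y₀ (ρ' / 2) ↔ _
    rw [mem_ball, dist_eq_norm]
  have hBlens : ∀ y ∈ B, ∀ {k : ℝ}, 0 < k → ‖E4.ofTimeSpace 0 y - x₀‖ < ρ' ∧
      |E4.ofTimeSpace 0 y 0| + k * ‖E4.ofTimeSpace 0 y - x₀‖ < k * (ρ' / 2) :=
    fun y hy k hk ↦ E4.ofTimeSpace_mem_lens hx₀0 hk ((hmemB y).1 hy)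
  have hBT : ∀ y ∈ B, E4.ofTimeSpace 0 y ∈ T := by
    intro y hy
    have h1 := (hBlens y hy one_pos).1
    show E4.ofTimeSpace 0 y ∈ (T : Set E4)
    rw [hTball, mem_ball, dist_eq_norm]
    exact h1.trans_le hρ'r
  haveI : ConnectedSpace B :=
    isConnected_iff_connectedSpace.mp ((convex_ball y₀ (ρ' / 2)).isConnected
      ⟨y₀, mem_ball_self (half_pos hρ')⟩)
  have hsliceB : ∀ y : B, 0 < MetricCoord.lapseSq G CoordSlice.dt (E4.ofTimeSpace 0 y) ∧
      0 < CoordSlice.dt (τT.vectorField (CoordSlice.sliceEmbed hBT y) : E4) := by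
    intro y
    have h1 := (hBlens y y.2 one_pos).1
    exact hr₁ab (CoordSlice.sliceEmbed hBT y) (by
      rw [Subtype.dist_eq, dist_eq_norm]; exact h1.trans_le hρ'r₁)
  have hlapse : ∀ y : B, 0 < MetricCoord.lapseSq G CoordSlice.dt (E4.ofTimeSpace 0 y) :=
    fun y ↦ (hsliceB y).1
  have hslice0 : ∀ y : B, ((CoordSlice.sliceEmbed hBT y : T) : E4) 0 = 0 := fun y ↦
    E4.ofTimeSpace_apply_zero 0 (y : E3)
  have hfut : ∀ y : B, τT.IsFutureDirected (x := CoordSlice.sliceEmbed hBT y)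
      (CoordSlice.sliceNormalField hBT G y) := fun y ↦
    OpensChart.isFutureDirected_sliceNormal_of_pos τT hG
      (OpensChart.isInvertible_repr (g := gT.toPseudoRiemannianMetric) hG _) (hlapse y)
      (hsliceB y).2
  /- Step 5: the common slice data and the two data embeddings -/
  haveI hLCa : gT.toPseudoRiemannianMetric.HasLeviCivita :=
    gT.toPseudoRiemannianMetric.hasLeviCivita
  haveI hLCb : gT'.toPseudoRiemannianMetric.HasLeviCivita :=
    gT'.toPseudoRiemannianMetric.hasLeviCivita
  obtain ⟨D, hDh, hDk⟩ := CoordSlice.exists_initialDataSet (hBT := hBT) hG hlapse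
  have hDk' : ∀ [inst : gT.toPseudoRiemannianMetric.HasLeviCivita] (y : B), (D.k y).toLinearMap₁₂ =
      gT.toPseudoRiemannianMetric.secondFundamentalForm 𝓘(ℝ, E3) (CoordSlice.sliceEmbed hBT)
        (CoordSlice.sliceNormalField hBT G) y := by
    intro inst y
    rw [hDk y]
  set 𝒮a : DataEmbedding D :=
    CoordSlice.sliceDataEmbedding hTconn gT τT hG hBT D hDh hDk' hlapse hfut with h𝒮a_def
  have h0 : ∀ y : B, G (E4.ofTimeSpace 0 y) = G' (E4.ofTimeSpace 0 y) := fun y ↦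
    (hagree (CoordSlice.sliceEmbed hBT y) (hslice0 y)).1
  have h1 : ∀ y : B, fderiv ℝ G (E4.ofTimeSpace 0 y) = fderiv ℝ G' (E4.ofTimeSpace 0 y) := fun y ↦
    (hagree (CoordSlice.sliceEmbed hBT y) (hslice0 y)).2
  obtain ⟨hDhb, hDkb⟩ := CoordSlice.initialDataSet_congr (hBT := hBT) hG hG' h0 h1 hlapse hDh hDk
  have hlapseb : ∀ y : B, 0 < MetricCoord.lapseSq G' CoordSlice.dt (E4.ofTimeSpace 0 y) :=
    CoordSlice.lapseSq_pos_congr h0 hlapse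
  have hNN : CoordSlice.sliceNormalField hBT G' = CoordSlice.sliceNormalField hBT G :=
    (CoordSlice.sliceNormalField_congr h0).symm
  have hfutb : ∀ y : B, τT'.IsFutureDirected (x := CoordSlice.sliceEmbed hBT y)
      (CoordSlice.sliceNormalField hBT G' y) := fun y ↦ by
    rw [hNN]
    exact isFutureDirected_transfer_of_agree τT τT' (hval_agree _ (hslice0 y))
      (hconex _ (hslice0 y)).2.1 (hfut y)
  set 𝒮b : DataEmbedding D :=
    CoordSlice.sliceDataEmbedding hTconn gT' τT' hG' hBT D hDhb hDkb hlapseb hfutb with h𝒮b_def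
  have hRicT : ∀ [inst : gT.toPseudoRiemannianMetric.HasLeviCivita],
      gT.toPseudoRiemannianMetric.IsRicciFlat := by
    intro inst
    haveI := 𝒟₁.metric.toPseudoRiemannianMetric.hasLeviCivita
    exact CoordChart.isRicciFlat_lorentzMetric 𝒟₁.metric hΦ 𝒟₁.isRicciFlat
  have hRicT' : ∀ [inst : gT'.toPseudoRiemannianMetric.HasLeviCivita],
      gT'.toPseudoRiemannianMetric.IsRicciFlat := by
    intro inst
    haveI := 𝒟₂.metric.toPseudoRiemannianMetric.hasLeviCivita
    exact LorentzianMetric.isRicciFlat_comap 𝒟₂.metric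
      PseudoRiemannianMetric.contMDiff_pullbackBilin_holds hψΦs' hψΦinj rfl 𝒟₂.isRicciFlat
  have hvac_a : 𝒮a.IsVacuum :=
    CoordSlice.sliceDataEmbedding_isVacuum hTconn gT τT hG hBT D hDh hDk' hlapse hfut hRicT
  have hvac_b : 𝒮b.IsVacuum :=
    CoordSlice.sliceDataEmbedding_isVacuum hTconn gT' τT' hG' hBT D hDhb hDkb hlapseb hfutb hRicT'
  /- Step 6: the lenses over the ball -/
  obtain ⟨Va, hVa_mem, haVa, -, hCa⟩ := Ha ρ' hρ' hρ'a
  obtain ⟨Vb, hVb_mem, haVb, -, hCb⟩ := Hb ρ' hρ' hρ'b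
  have hconn_a : IsConnected (Va : Set T) :=
    isConnected_lens_opens hTball hx₀0 (a := a) rfl hka hρ' hρ'r Va hVa_mem
  have hconn_b : IsConnected (Vb : Set T) :=
    isConnected_lens_opens hTball hx₀0 (a := a) rfl hkb hρ' hρ'r Vb hVb_mem
  have hιa : ∀ y : B, CoordSlice.sliceEmbed hBT y ∈ Va := fun y ↦ (hVa_mem _).2 (hBlens y y.2 hka)
  have hιb : ∀ y : B, CoordSlice.sliceEmbed hBT y ∈ Vb := fun y ↦ (hVb_mem _).2 (hBlens y y.2 hkb)
  have hCa' : (𝒮a.metric.restrict PseudoRiemannianMetric.contMDiff_restrict_holds Va).IsCauchyHypersurface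
      (𝒮a.timeOrientation.restrict PseudoRiemannianMetric.contMDiff_restrict_holds
        𝒮a.timeOrientation.contMDiff_restrict_holds Va) (range (𝒮a.embedOpens Va hιa)) := by
    have h := range_sliceEmbed_lens_eq (a := a) rfl hka hmemB hBT Va hVa_mem hιa
    change (gT.restrict PseudoRiemannianMetric.contMDiff_restrict_holds Va).IsCauchyHypersurface
      (τT.restrict PseudoRiemannianMetric.contMDiff_restrict_holds τT.contMDiff_restrict_holds Va)
      (range (fun y : B ↦ (⟨CoordSlice.sliceEmbed hBT y, hιa y⟩ : Va)))
    rw [h]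
    exact hCa
  have hCb' : (𝒮b.metric.restrict PseudoRiemannianMetric.contMDiff_restrict_holds Vb).IsCauchyHypersurface
      (𝒮b.timeOrientation.restrict PseudoRiemannianMetric.contMDiff_restrict_holds
        𝒮b.timeOrientation.contMDiff_restrict_holds Vb) (range (𝒮b.embedOpens Vb hιb)) := by
    have h := range_sliceEmbed_lens_eq (a := a) rfl hkb hmemB hBT Vb hVb_mem hιb
    change (gT'.restrict PseudoRiemannianMetric.contMDiff_restrict_holds Vb).IsCauchyHypersurface
      (τT'.restrict PseudoRiemannianMetric.contMDiff_restrict_holds τT'.contMDiff_restrict_holds Vb)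
      (range (fun y : B ↦ (⟨CoordSlice.sliceEmbed hBT y, hιb y⟩ : Vb)))
    rw [h]
    exact hCb
  /- Step 7: the abstract restart, with `χa = Φ⁻¹`, `χb = ψΦ`, `e = id` -/
  have hψΦo : IsOpenEmbedding ψΦ :=
    IsOpenEmbedding.of_continuous_injective_isOpenMap (hψΦs'.of_le le_self_add).continuous
      hψΦinjective
      (LorentzianMetric.isLocalDiffeomorph_of_isIsometricImmersion hψΦi).isOpenMap
  have he : (id : T → T) ∘ 𝒮a.embed = 𝒮b.embed := rfl
  have hed : ∀ y : B, MDifferentiableAt (𝓡 4) (𝓡 4) (id : T → T) (𝒮a.embed y) := fun _ ↦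
    mdifferentiableAt_id
  have heν : ∀ y : B, mfderiv (𝓡 4) (𝓡 4) (id : T → T) (𝒮a.embed y) (𝒮a.normal y) = 𝒮b.normal y := by
    intro y
    rw [mfderiv_id]
    show CoordSlice.sliceNormalField hBT G y = CoordSlice.sliceNormalField hBT G' y
    rw [hNN]
  have hψe : ∀ x : T, ψ (CoordChart.inv Φ x) = ψΦ (id x) := fun _ ↦ rfl
  -- the point `p₀` lies on the slice image, the slice lies over `{f = 0}`
  have hy₀B : y₀ ∈ B := (hmemB y₀).2 (by rw [sub_self, norm_zero]; exact half_pos hρ')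
  have hp₀ι : CoordChart.inv Φ (CoordSlice.sliceEmbed hBT ⟨y₀, hy₀B⟩) = p₀ := by
    show Φ.symm (E4.ofTimeSpace 0 y₀) = p₀
    have h : E4.ofTimeSpace 0 y₀ = x₀ := by
      have h := E4.ofTimeSpace_time_spatial x₀
      rw [E4.time_apply, hx₀0] at h
      exact h
    rw [h, hsymm₀]
  have hfzero : ∀ y : B, f (CoordChart.inv Φ (CoordSlice.sliceEmbed hBT y)) = 0 := by
    intro y
    have hsrc : CoordChart.inv Φ (CoordSlice.sliceEmbed hBT y) ∈ Φ.source :=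
      CoordChart.inv_mem_source _
    rw [← hΦf _ hsrc]
    show (Φ (Φ.symm (E4.ofTimeSpace 0 y))) 0 = 0
    rw [Φ.right_inv (hBT y y.2)]
    exact E4.ofTimeSpace_apply_zero 0 (y : E3)
  have hrangeW : range (CoordChart.inv Φ) ⊆ W := fun q hq ↦ by
    obtain ⟨x, rfl⟩ := hq; exact hOW (hinvO x)
  have hrangeI : range (CoordChart.inv Φ) ⊆
        𝒟₁.metric.chronologicalFuture 𝒟₁.timeOrientation (range 𝒟₁.embed) ∨
      range (CoordChart.inv Φ) ⊆
        𝒟₁.metric.chronologicalPast 𝒟₁.timeOrientation (range 𝒟₁.embed) := by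
    have h0 : range (CoordChart.inv Φ) ⊆ Ipm := fun q hq ↦ by
      obtain ⟨x, rfl⟩ := hq; exact (hinvO x).2
    rcases hIpm with h | h
    · exact Or.inl (h0.trans h)
    · exact Or.inr (h0.trans h)
  exact ⟨B, inferInstance, D, 𝒮a, 𝒮b, Va, hιa, Vb, hιb, CoordChart.inv Φ, ψΦ, id, hvac_a, hvac_b,
    hconn_a, hCa', hconn_b, hCb', hinvo, hinvi, hinvτ, hψΦo, hψΦi, hψΦτ, he, hed, heν, hψe, hrangeW,
    hrangeI, hfzero, ⟨y₀, hy₀B⟩, hp₀ι⟩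

end SubdataDevelopmentsEmbed

end Summit.FinalStateConjecture.FinalStateConjecture.Theorems

end
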